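/-
Copyright (c) 2026 the pub-hodgecm-mathlib formalisation cell (harness21).  Prover seat hodgecm-mathlib-LH4-p13 (g7), req620 Track A «(D-RAM) FOUR-FRAME» squad, tier 0,
STAGE-1b PRE-SCOPING (heir LEAD F0P3a-plan (g20) T19-24 «allowed as scoping»): organ (L-lab) «THE LABEL LAW» of the rows `stub_rows_transvPlus ∕ stub_rows_transvMinus`
— brick (L-lab-4) «A σ-FIXED REPRESENTATIVE OF THE ONE-SLOT SCALAR»: `e′ = e·(1 + σα)∕2`, closing the chain ★ p858717 → ★ p858774 → ★ p858873 → p858904 to an EXPLICIT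
norm-class test under an explicit depth window (PRESCOPE (L-lab) ae1fddd5 (Q1)).  2026-09-04.
-/
import Summits.HodgeConjecture.HodgeConjecture.Theorems.F0P3cDyRamSmulXPlusLabel   -- (L-lab-3) (this seat): `labelPlus_smul_xPlus_iff_exists_norm_of_congr`; brings the chain
import HarnessLib

/-!
# Crux `H413`, line LH4 «(D-RAM) FOUR-FRAME», tier 0, STAGE-1b pre-scoping — (L-lab-4): the σ-fixed representative `e·(1 + σα)∕2` of the one-slot scalar

Cell `hodgecm-mathlib` (D-0151), FLOOR 0, crux item H413 = `stmt-HodgeConjecture-24833`, route of record `HCCMUnconditional`; squad F0∕P3c∕LH4.  SCOPING INVENTORY (PLAN-T1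
v19 (L-lab)); THEOREMS ONLY (no `def`, no instance, no notation, no `sorry`, default heartbeats), ★-only imports, lane `--supports stmt-HodgeConjecture-24833 --as helper`;
pays NO row, states NO law.

THE MATHEMATICS.  The one-slot scalar `e` of ★ (L-lab-1)∕(L-lab-2) satisfies `σe = e·σα` (★ (L-lab-3) `map_oneSlot_scalar`; `α ∈ E¹`).  Then **`e′ := e·(1 + σα)∕2` is σ-FIXED**
(`σe′ = e·σα·(1 + α)∕2 = e·(σα + ασα)∕2 = e′` since `ασα = 1`), `e − e′ = e·(1 − σα)∕2` so **`|e − e′| = |e|·|α − 1|∕|2|`**, and `|e′| = |e|` as soon as `|α − 1| < |2|`.  Feeding `e′`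
to ★ (L-lab-3) `labelPlus_smul_xPlus_iff_exists_norm_of_congr`: under the EXPLICIT window `|(ϖ^{m*})⁻¹·(e·(1 − σα)∕2·t₊)| ≤ 1` (i.e. `v(α−1) ≥ m* − ℓ₀ + v_E(2)` on the unit
layer), `LabelPlus σ ϖ d m* (e • X₊) ↔ e·(1 + σα)∕2 ∈ N(E^×)` — the label of an elliptic frame element at a one-slot-dominant vertex is the NORM CLASS of an explicit element of
`F`, in which `N(f b i)` enters as a factor (κ_i(b)).  Below that window the question (Q1) of the PRESCOPE note stands (better `F`-approximants may exist; census tables decide).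
* §1 `map_fixedRep`, `sub_fixedRep`, `v_sub_fixedRep`, `v_fixedRep` — the algebra of `e′`.
* §2 **`labelPlus_smul_xPlus_iff_exists_norm_fixedRep`** — the chain's end: label ↔ norm class of `e·(1 + σα)∕2`, under the window.
HONEST LABEL.  Count-neutral scoping brick; the three tier-0 rows stay OPEN; `HC_CM` is proved only modulo the 7 printed citations (2 remaining named inputs: hLiu418 =
`stmt-HodgeConjecture-24832`, h413 = `stmt-HodgeConjecture-24833`) until rung 0 closes.

## References
* [Serre1979] J.-P. Serre, *Local Fields*, GTM 67 (1979), Ch. V §3 Cor. 3 (norm classes of units; conductor of a ramified quadratic extension).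
* [Rogawski1990] J. D. Rogawski, *Automorphic Representations of Unitary Groups in Three Variables*, Ann. of Math. Stud. 123 (1990), §4.9 Prop. 4.9.1 (b) p. 55.
* [LanglandsShelstad1987] R. P. Langlands, D. Shelstad, *On the definition of transfer factors*, Math. Ann. 278 (1987), §3.
-/

set_option autoImplicit false

noncomputable section

namespace Summit.HodgeConjecture.HodgeConjecture.Cruxes.H413.F0P3cDyRamOneSlotScalarFixedRep

open Literature.NumberTheory.Automorphic.UnitaryThreeFourFrame
open Summit.HodgeConjecture.HodgeConjecture.Cruxes.H413.F0P3cDyRamFourFramePieces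
open Summit.HodgeConjecture.HodgeConjecture.Cruxes.H413.F0P3cDyRamSmulXPlusLabel (labelPlus_smul_xPlus_iff_exists_norm_of_congr)
open scoped Valued
open WithZero

variable {K : Type} [Field K]

/-! ## §1  The σ-fixed representative `e′ = e·(1 + σα)∕2` -/

/-- **`e′ = e·(1 + σα)∕2` IS σ-FIXED** when `σe = e·σα`, `ασα = 1`, `σ` an involution (`σ2 = 2`). [cite: Serre1979, Ch. V §3 Cor. 3] -/
theorem map_fixedRep {σ : K →+* K} (hσσ : ∀ a, σ (σ a) = a) {α e : K} (hα : α * σ α = 1) (he : σ e = e * σ α) :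
    σ (e * (1 + σ α) / 2) = e * (1 + σ α) / 2 := by
  rw [map_div₀, map_mul, map_add, map_one, hσσ, he, map_ofNat]
  congr 1
  linear_combination e * hα

/-- `e − e′ = e·(1 − σα)∕2`. [cite: Serre1979, Ch. V §3 Cor. 3] -/
theorem sub_fixedRep [NeZero (2 : K)] (σ : K →+* K) (α e : K) : e - e * (1 + σ α) / 2 = e * (1 - σ α) / 2 := by
  have h2 : (2 : K) ≠ 0 := NeZero.ne 2
  field_simp
  ring

variable [Valued K ℤᵐ⁰]

/-- **`|e − e′| = |e|·|α − 1|∕|2|`** (`σ` isometric; `|1 − σα| = |σ(1 − α)| = |α − 1|`). [cite: Serre1979, Ch. V §3 Cor. 3] -/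
theorem v_sub_fixedRep [NeZero (2 : K)] {σ : K →+* K} (hvσ : ∀ a, Valued.v (σ a) = Valued.v a) (α e : K) :
    Valued.v (e - e * (1 + σ α) / 2) = Valued.v e * Valued.v (α - 1) / Valued.v (2 : K) := by
  rw [sub_fixedRep σ α e, map_div₀, map_mul]
  congr 2
  rw [show (1 : K) - σ α = σ (1 - α) by rw [map_sub, map_one], hvσ, Valuation.map_sub_swap]

/-- **`|e′| = |e|` when `|α − 1| < |2|`** (then `|1 + σα| = |2 + (σα − 1)| = |2|`). [cite: Serre1979, Ch. V §3 Cor. 3] -/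
theorem v_fixedRep [NeZero (2 : K)] {σ : K →+* K} (hvσ : ∀ a, Valued.v (σ a) = Valued.v a) {α : K} (hα1 : Valued.v (α - 1) < Valued.v (2 : K)) (e : K) :
    Valued.v (e * (1 + σ α) / 2) = Valued.v e := by
  have h2 : Valued.v (2 : K) ≠ 0 := (Valuation.ne_zero_iff _).2 (NeZero.ne 2)
  have h12 : Valued.v (1 + σ α) = Valued.v (2 : K) := by
    rw [show (1 : K) + σ α = 2 + σ (α - 1) by rw [map_sub, map_one]; ring]
    exact Valuation.map_add_eq_of_lt_left _ (by rw [hvσ]; exact hα1)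
  rw [map_div₀, map_mul, h12, mul_div_assoc, div_self h2, mul_one]

/-! ## §2  The end of the one-slot chain: an explicit norm-class test under an explicit window -/

/-- **THE LABEL OF `e • X₊` AS THE NORM CLASS OF `e·(1 + σα)∕2`.**  Over a complete sheet datum `IsRamifiedQuadraticDatum σ ϖ d t` (`m* = d % 2 + 2d − 1`, `t₊` the reference
skew scalar), for a UNIT scalar `e` with `σe = e·σα` (`ασα = 1`, `|α − 1| < |2|`) inside the window `|(ϖ^{m*})⁻¹·(e·(1 − σα)∕2 · t₊)| ≤ 1`:
`LabelPlus σ ϖ d m* (e • xPlus σ ϖ d) ↔ ∃ z, z·σz = e·(1 + σα)∕2` (★ (L-lab-3) at the σ-fixed representative of §1).  With ★ (L-lab-1)∕(L-lab-2) this is the label of the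
elliptic frame element `γ_b` at a one-slot-dominant vertex, as the norm class of an explicit `F`-element carrying the factor `N(f b i)⁻¹` (κ_i(b)).
[cite: Serre1979, Ch. V §3 Cor. 3] [cite: Rogawski1990, §4.9 Prop. 4.9.1 (b) p. 55] [cite: LanglandsShelstad1987, §3] -/
theorem labelPlus_smul_xPlus_iff_exists_norm_fixedRep [IsAdicComplete 𝓂[K] 𝒪[K]] [NeZero (2 : K)] {σ : K →+* K} {ϖ : K} {d t : ℕ}
    (hD : IsRamifiedQuadraticDatum σ ϖ d t) {α e : K} (hα : α * σ α = 1) (hα1 : Valued.v (α - 1) < Valued.v (2 : K)) (he : σ e = e * σ α)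
    (he1 : Valued.v e = 1)
    (hwin : Valued.v ((ϖ ^ (d % 2 + 2 * d - 1))⁻¹ * (e * (1 - σ α) / 2 * ((ϖ - σ ϖ) * ((ϖ * σ ϖ) ^ ((d - d % 2) / 2))⁻¹))) ≤ 1) :
    LabelPlus σ ϖ d (d % 2 + 2 * d - 1) (e • xPlus σ ϖ d) ↔ ∃ z : K, z * σ z = e * (1 + σ α) / 2 := by
  have hσσ : ∀ a, σ (σ a) = a := hD.1
  have hvσ : ∀ a, Valued.v (σ a) = Valued.v a := hD.2.1
  refine labelPlus_smul_xPlus_iff_exists_norm_of_congr hD (map_fixedRep hσσ hα he) (by rw [v_fixedRep hvσ hα1, he1]) ?_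
  rw [sub_fixedRep σ α e]
  exact hwin

end Summit.HodgeConjecture.HodgeConjecture.Cruxes.H413.F0P3cDyRamOneSlotScalarFixedRep

end
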